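import Literature.NumberTheory.Automorphic.IrreducibleClassesConstituents
import Literature.NumberTheory.Automorphic.SmoothCharacterOfCharacter
import Literature.NumberTheory.Automorphic.GL2SphericalOfLFactorDegreeTwo
import Literature.NumberTheory.Automorphic.UnitaryGroupCohomologicalForms
import Literature.NumberTheory.Automorphic.UnitaryGroupPlaceInclusion
import Literature.NumberTheory.Automorphic.FinAdelicTotallyDisconnected
import Literature.GroupTheory.PiCharacterFactorsFinitely
import HarnessLib

/-!
# The constituents of a representation on which the group acts by a character, and the finite local constituents of a
# discrete automorphic representation of `U(J)` on which `U(J)(𝔸_F)` acts by a character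

Topic `NumberTheory/Automorphic`; namespace `Literature.NumberTheory.Automorphic` (§1 under `IrrClass`, §2–§3 under `UnitaryGroup`).
THEOREMS ONLY (kernel lane): no `def`, no named fact, no instance, no notation, no `sorry`.

* §1 **Constituents of a `χ`-scalar representation** (generic topological group `G`, smooth character `χ : G →* ℂˣ` with open kernel).
  If `G` acts on `V ≠ 0` through `χ` (`ρ g v = χ(g) v`), the constituents (★ `IrrClass.IsConstituentOf`: classes of irreducible smooth
  subquotients) of `ρ` are EXACTLY `{⟦χ⟧}` (★ `SmoothIrrep.ofChar`): every subquotient is again `χ`-scalar, an irreducible `χ`-scalar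
  representation is a line (★ `finrank_eq_one_of_isIrreducible_of_smul`), and a `χ`-scalar line is `⟦χ⟧`; conversely `z ↦ z v₀` embeds `⟦χ⟧`
  (`isConstituentOf_iff_eq_mk_ofChar_of_forall_apply_eq_smul`). [BushnellHenniart2006, §1.1, §1.5, §2]
* §2 **Continuous characters of `U(J)(𝔸_{F,f})` are smooth**: a continuous `c : U(J)(𝔸_{F,f}) →* ℂˣ` has open kernel — `U(J)(𝔸_{F,f})` is
  totally disconnected (★ `totallyDisconnectedSpace_finAdelic`) with the compact open subgroup `∏_v U(J)(𝒪_v)` (★ `finAdelicIntegralLevel`), and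
  `ℂˣ` has no small subgroups (★ `isOpen_ker_units_complex`); the generic step `isOpen_ker_of_isCompact_isOpen_subgroup` is the
  Literature twin of the crux-side ★ `F0P3XiLocalCharOpenKernel.isOpen_ker_of_continuous_of_isCompact_isOpen_subgroup`. [BushnellHenniart2006, §1.5]
* §3 **The finite local constituents of a character line.**  Let `P` be a discrete automorphic representation of the unitary datum
  `UnitaryGroup.adelicGroupData F E c N J` (★) on which `U(J)(𝔸_F)` acts through a continuous character `χ` (`R(g)|_P = χ(g)`; e.g. every `P`
  of a rank-one datum, ★ `AutomorphicCharacterLine`).  Then the restriction `P|_{U(J)(𝔸_{F,f})}` (★ `DiscreteAutomorphicRep.finRep`) is SMOOTH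
  (`finRep_smoothPart_eq_top_of_forall_apply_eq_smul`), and at every finite place `v` the constituents of its smooth part restricted along
  ★ `inclPlace v` are EXACTLY the class of the smooth character `χ_v = χ ∘ ι_v` of `U(J)(F_v)`, `ι_v =` ★ `inclPlaceAdelic v`
  (`isConstituentOf_finRep_smoothPart_comp_inclPlace_iff_of_forall_apply_eq_smul`) — the clause that the relational currency
  «the finite constituents of `P` at `v` are exactly …» (★ `Rogawski1990.LocalConstituentsIn`, crux-side `Realises₂∕₁`) asks for.
  [BorelJacquet1979, §4.6] [FlathCorvallis1979, Thm. 3]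

HC_CM is proved only modulo the printed citations until rung 0 closes; this file is generic representation theory and moves no count.

## References
* [BushnellHenniart2006] C. Bushnell, G. Henniart, *The local Langlands conjecture for GL(2)* (2006), §1.1, §1.5 (characters of locally profinite
  groups are smooth), §2 (subquotients).
* [BorelJacquet1979] A. Borel, H. Jacquet, *Automorphic forms and automorphic representations*, Corvallis (1979), §4.6.
* [FlathCorvallis1979] D. Flath, *Decomposition of representations into tensor products*, Corvallis (1979), Thm. 3.
-/

set_option autoImplicit false

noncomputable section

open NumberField IsDedekindDomain MeasureTheory Topology

namespace Literature.NumberTheory.Automorphic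

universe u

/-! ## §1 Constituents of a `χ`-scalar representation -/

namespace IrrClass

variable {G : Type u} [Group G] [TopologicalSpace G] [IsTopologicalGroup G]

/-- **The constituents of a representation on which `G` acts through a smooth character `χ` are exactly `{⟦χ⟧}`** (`V ≠ 0`): every irreducible
smooth subquotient `N₁ ⁄ N₂` is `χ`-scalar, hence a line (★ `finrank_eq_one_of_isIrreducible_of_smul`) equivalent to `ℂ_χ` (★ `SmoothIrrep.ofChar`);
conversely `z ↦ z • v₀`, `v₀ ≠ 0`, embeds `ℂ_χ`. [cite: BushnellHenniart2006, §1.5] [cite: BushnellHenniart2006, §2] -/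
theorem isConstituentOf_iff_eq_mk_ofChar_of_forall_apply_eq_smul {V : Type} [AddCommGroup V] [Module ℂ V] [Nontrivial V]
    (ρ : Representation ℂ G V) (χ : G →* ℂˣ) (hχ : IsOpen ((χ.ker : Subgroup G) : Set G)) (h : ∀ (g : G) (v : V), ρ g v = ((χ g : ℂˣ) : ℂ) • v)
    (c : IrrClass G) : c.IsConstituentOf ρ ↔ c = IrrClass.mk (SmoothIrrep.ofChar χ hχ) := by
  constructor
  · rintro ⟨r, rfl, N₁, N₂, hle, ⟨φ⟩⟩
    -- the subquotient `N₁ ⁄ N₂` is `χ`-scalar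
    have hQ : ∀ (g : G) (q : ↥N₁.toSubmodule ⧸ N₂.toSubmodule.comap N₁.toSubmodule.subtype),
        (N₁.toRepresentation.quotient (N₂.toSubmodule.comap N₁.toSubmodule.subtype)
          fun g _ hx ↦ N₂.apply_mem_toSubmodule g hx) g q = ((χ g : ℂˣ) : ℂ) • q := by
      intro g q
      induction q using Submodule.Quotient.induction_on with
      | H x =>
        rw [Representation.quotient_apply, Submodule.mapQ_apply, ← Submodule.Quotient.mk_smul]
        congr 1
        exact Subtype.ext (h g x)
    -- hence so is `r.ρ`
    have hr : ∀ (g : G) (w : r.V), r.ρ g w = ((χ g : ℂˣ) : ℂ) • w := by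
      intro g w
      apply φ.toLinearEquiv.injective
      have h1 := φ.toIntertwiningMap.isIntertwining r.ρ _ g w
      change φ.toLinearEquiv (r.ρ g w) = _ at h1
      rw [h1, hQ, ← map_smul]
      rfl
    -- so `r.V` is a line
    obtain ⟨_, h1⟩ := finrank_eq_one_of_isIrreducible_of_smul r.ρ fun g => ⟨((χ g : ℂˣ) : ℂ), hr g⟩
    obtain ⟨w, hw0, hw⟩ := finrank_eq_one_iff'.1 h1
    -- `z ↦ z • w : ℂ_χ ≃ r.ρ`
    have hbij : Function.Bijective (LinearMap.toSpanSingleton ℂ r.V w) := by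
      refine ⟨fun a b hab => smul_left_injective ℂ hw0 hab, fun x => ?_⟩
      obtain ⟨a, ha⟩ := hw x
      exact ⟨a, ha⟩
    let e : ℂ ≃ₗ[ℂ] r.V := LinearEquiv.ofBijective (LinearMap.toSpanSingleton ℂ r.V w) hbij
    have he : ∀ g : G, (e : ℂ →ₗ[ℂ] r.V) ∘ₗ (SmoothIrrep.ofChar χ hχ).ρ g = r.ρ g ∘ₗ (e : ℂ →ₗ[ℂ] r.V) := by
      intro g
      refine LinearMap.ext fun (z : ℂ) => ?_
      change e ((SmoothIrrep.ofChar χ hχ).ρ g z) = r.ρ g (e z)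
      rw [SmoothIrrep.ofChar_ρ_apply]
      change (((χ g : ℂˣ) : ℂ) * z) • w = r.ρ g (z • w)
      rw [hr, smul_smul]
    exact (IrrClass.mk_eq_mk_of_equiv (Representation.Equiv.mk e he)).symm
  · rintro rfl
    obtain ⟨v₀, hv₀⟩ := exists_ne (0 : V)
    have hf : ∀ (g : G) (z : ℂ),
        LinearMap.toSpanSingleton ℂ V v₀ ((SmoothIrrep.ofChar χ hχ).ρ g z) = ρ g (LinearMap.toSpanSingleton ℂ V v₀ z) := by
      intro g z
      have e1 : (SmoothIrrep.ofChar χ hχ).ρ g z = ((χ g : ℂˣ) : ℂ) * z := SmoothIrrep.ofChar_ρ_apply χ hχ g z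
      rw [e1, LinearMap.toSpanSingleton_apply, LinearMap.toSpanSingleton_apply, h, smul_smul]
    exact (isConstituentOf_mk_self (SmoothIrrep.ofChar χ hχ)).of_injective
      (LinearMap.intertwiningMap_of_isIntertwiningMap _ _ (LinearMap.toSpanSingleton ℂ V v₀) hf) fun a b hab =>
      smul_left_injective ℂ hv₀ hab

omit [TopologicalSpace G] [IsTopologicalGroup G] in
/-- Restriction form: if `G` acts on `V ≠ 0` through `χ`, then along any `φ : H →* G` the constituents of `ρ ∘ φ` are exactly `{⟦χ ∘ φ⟧}`.
[cite: BushnellHenniart2006, §1.5] [cite: BushnellHenniart2006, §2] -/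
theorem isConstituentOf_comp_iff_eq_mk_ofChar_of_forall_apply_eq_smul {H : Type u} [Group H] [TopologicalSpace H] [IsTopologicalGroup H]
    {V : Type} [AddCommGroup V]
    [Module ℂ V] [Nontrivial V] (ρ : Representation ℂ G V) (χ : G →* ℂˣ) (φ : H →* G)
    (hχφ : IsOpen (((χ.comp φ).ker : Subgroup H) : Set H)) (h : ∀ (g : G) (v : V), ρ g v = ((χ g : ℂˣ) : ℂ) • v) (c : IrrClass H) :
    c.IsConstituentOf (ρ.comp φ) ↔ c = IrrClass.mk (SmoothIrrep.ofChar (χ.comp φ) hχφ) :=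
  isConstituentOf_iff_eq_mk_ofChar_of_forall_apply_eq_smul (ρ.comp φ) (χ.comp φ) hχφ (fun x v => h (φ x) v) c

end IrrClass

/-! ## §2 Continuous characters of `U(J)(𝔸_{F,f})` have open kernel -/

/-- **A continuous character `c : G →* ℂˣ` of a totally disconnected topological group with a compact open subgroup `K` has OPEN KERNEL**
(`c|_K` kills an open subgroup of the profinite `K` — ★ `isOpen_ker_units_complex` — whose image is open in `G`).  Literature twin of the crux-side
★ `F0P3XiLocalCharOpenKernel.isOpen_ker_of_continuous_of_isCompact_isOpen_subgroup`. [cite: BushnellHenniart2006, §1.5] -/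
theorem isOpen_ker_of_isCompact_isOpen_subgroup {G : Type u} [Group G] [TopologicalSpace G] [IsTopologicalGroup G] [TotallyDisconnectedSpace G]
    (K : Subgroup G) (hKc : IsCompact (K : Set G)) (hKo : IsOpen (K : Set G)) (c : G →* ℂˣ) (hc : Continuous c) :
    IsOpen ((c.ker : Subgroup G) : Set G) := by
  haveI : CompactSpace K := isCompact_iff_compactSpace.mp hKc
  have hK : IsOpen (((c.comp K.subtype).ker : Subgroup K) : Set K) :=
    Literature.GroupTheory.PiCharacter.isOpen_ker_units_complex (c.comp K.subtype) (hc.comp continuous_subtype_val)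
  have hle : ((c.comp K.subtype).ker.map K.subtype : Subgroup G) ≤ c.ker := by
    rintro _ ⟨x, hx, rfl⟩
    simpa [MonoidHom.mem_ker] using hx
  refine Subgroup.isOpen_mono hle ?_
  have himg : (((c.comp K.subtype).ker.map K.subtype : Subgroup G) : Set G) = Subtype.val '' (((c.comp K.subtype).ker : Subgroup K) : Set K) := by
    ext x
    simp only [Subgroup.coe_map, Subgroup.coe_subtype]
  rw [himg]
  exact hKo.isOpenEmbedding_subtypeVal.isOpenMap _ hK

/-- A homomorphism `φ : G →* Mˣ` is continuous as soon as `g ↦ (φ g : M)` is (the second coordinate of the units embedding is `g ↦ φ(g⁻¹)`);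
copy of the root-level lemma of ★ `GLOneStandardLTate`, kept private to avoid the heavy import. [cite: BushnellHenniart2006, §1.5] -/
private theorem continuous_units_of_continuous_val {G M : Type*} [Group G] [TopologicalSpace G] [ContinuousInv G] [Monoid M] [TopologicalSpace M]
    (φ : G →* Mˣ) (h : Continuous fun g => (φ g : M)) : Continuous φ := by
  refine Units.continuous_iff.mpr ⟨h, (h.comp continuous_inv).congr fun g => ?_⟩
  simp only [Function.comp_apply, map_inv]

namespace UnitaryGroup

variable {F E : Type} [Field F] [NumberField F] [Field E] [NumberField E] [Algebra F E] {c : E ≃ₐ[F] E} {N : ℕ}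
  {J : Matrix (Fin N) (Fin N) E}

omit [NumberField F] in
/-- **A continuous character of `U(J)(𝔸_{F,f})` has open kernel** (is smooth): `U(J)(𝔸_{F,f})` is totally disconnected (★ `totallyDisconnectedSpace_finAdelic`)
with the compact open subgroup `∏_v U(J)(𝒪_v)` (★ `finAdelicIntegralLevel`). [cite: BushnellHenniart2006, §1.5] -/
theorem isOpen_ker_of_continuous_finAdelic (χ : finAdelic F E c N J →* ℂˣ) (hχ : Continuous χ) :
    IsOpen ((χ.ker : Subgroup (finAdelic F E c N J)) : Set (finAdelic F E c N J)) := by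
  haveI : TotallyDisconnectedSpace ↥(finAdelic F E c N J) := totallyDisconnectedSpace_finAdelic F E c N J
  exact isOpen_ker_of_isCompact_isOpen_subgroup (finAdelicIntegralLevel F E c N J) (isCompact_finAdelicIntegralLevel F E c N J)
    (isOpen_finAdelicIntegralLevel F E c N J) χ hχ

/-- The restriction to `U(J)(𝔸_{F,f})` (along ★ `finAdelicToAdelic`) of a continuous character of `U(J)(𝔸_F)` has open kernel. [cite: BushnellHenniart2006, §1.5] -/
theorem isOpen_ker_comp_finAdelicToAdelic (χ : (adelicGroupData F E c N J).Adelic →* ℂˣ) (hχ : Continuous fun g => ((χ g : ℂˣ) : ℂ)) :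
    IsOpen (((χ.comp (finAdelicToAdelic F E c N J)).ker : Subgroup (finAdelic F E c N J)) : Set (finAdelic F E c N J)) :=
  isOpen_ker_of_continuous_finAdelic _
    (continuous_units_of_continuous_val _ (hχ.comp (continuous_finAdelicToAdelic (F := F) (E := E) (c := c) (N := N) (J := J))))

/-- The local component at `v` (along ★ `inclPlaceAdelic v = finAdelicToAdelic ∘ inclPlace v`) of a continuous character of `U(J)(𝔸_F)` has open kernel.
[cite: BushnellHenniart2006, §1.5] -/
theorem isOpen_ker_comp_inclPlaceAdelic (χ : (adelicGroupData F E c N J).Adelic →* ℂˣ) (hχ : Continuous fun g => ((χ g : ℂˣ) : ℂ))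
    (v : HeightOneSpectrum (𝓞 F)) :
    IsOpen (((χ.comp (inclPlaceAdelic F E c N J v)).ker : Subgroup (localPi E c N J v)) : Set (localPi E c N J v)) := by
  have h := (isOpen_ker_comp_finAdelicToAdelic χ hχ).preimage (continuous_inclPlace (F := F) (E := E) (c := c) (N := N) (J := J) v)
  have hs : (((χ.comp (inclPlaceAdelic F E c N J v)).ker : Subgroup (localPi E c N J v)) : Set (localPi E c N J v)) =
      inclPlace F E c N J v ⁻¹' (((χ.comp (finAdelicToAdelic F E c N J)).ker : Subgroup (finAdelic F E c N J)) : Set (finAdelic F E c N J)) :=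
    Set.ext fun _ => Iff.rfl
  rw [hs]
  exact h

/-! ## §3 The finite local constituents of a character line -/

variable {μ : Measure (adelicGroupData F E c N J).automorphicQuotient} [(adelicGroupData F E c N J).IsAutomorphicMeasure μ]

/-- If `U(J)(𝔸_F)` acts on `P` through `χ`, then `U(J)(𝔸_{F,f})` acts on `P|_{U(J)(𝔸_{F,f})}` through `χ ∘ finAdelicToAdelic`. [cite: BorelJacquet1979, §4.6] -/
theorem finRep_apply_of_forall_apply_eq_smul (P : DiscreteAutomorphicRep (adelicGroupData F E c N J) μ) (χ : (adelicGroupData F E c N J).Adelic →* ℂˣ)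
    (hP : ∀ (g : (adelicGroupData F E c N J).Adelic) (f : P.space.toSubmodule), P.space.toContRep g f = ((χ g : ℂˣ) : ℂ) • f)
    (y : finAdelic F E c N J) (f : P.space.toSubmodule) :
    P.finRep y f = ((χ (finAdelicToAdelic F E c N J y) : ℂˣ) : ℂ) • f :=
  hP _ f

/-- **A character line is smooth on the finite adeles**: if `U(J)(𝔸_F)` acts on `P` through a CONTINUOUS character `χ`, every vector of
`P|_{U(J)(𝔸_{F,f})}` is smooth (its stabiliser contains the open kernel of `χ|_{U(J)(𝔸_{F,f})}`).
[cite: BorelJacquet1979, §4.6] [cite: BushnellHenniart2006, §1.5] -/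
theorem isSmooth_finRep_of_forall_apply_eq_smul (P : DiscreteAutomorphicRep (adelicGroupData F E c N J) μ)
    (χ : (adelicGroupData F E c N J).Adelic →* ℂˣ) (hχ : Continuous fun g => ((χ g : ℂˣ) : ℂ))
    (hP : ∀ (g : (adelicGroupData F E c N J).Adelic) (f : P.space.toSubmodule), P.space.toContRep g f = ((χ g : ℂˣ) : ℂ) • f) :
    P.finRep.IsSmooth := by
  intro f
  refine Subgroup.isOpen_mono (H₁ := (χ.comp (finAdelicToAdelic F E c N J)).ker) (fun y hy => ?_) (isOpen_ker_comp_finAdelicToAdelic χ hχ)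
  rw [Representation.mem_stabilizerSubgroup, finRep_apply_of_forall_apply_eq_smul P χ hP]
  rw [MonoidHom.mem_ker] at hy
  change χ (finAdelicToAdelic F E c N J y) = 1 at hy
  rw [hy, Units.val_one, one_smul]

/-- **THE FINITE LOCAL CONSTITUENTS OF A CHARACTER LINE.**  If `U(J)(𝔸_F)` acts on the discrete automorphic representation `P` through a continuous
character `χ`, then at every finite place `v` the constituents of (the smooth part of) `P|_{U(J)(𝔸_{F,f})}` restricted along ★ `inclPlace v` are EXACTLY
the class of the smooth character `χ_v = χ ∘ inclPlaceAdelic v` of `U(J)(F_v)`. [cite: BorelJacquet1979, §4.6] [cite: FlathCorvallis1979, Thm. 3] -/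
theorem isConstituentOf_finRep_smoothPart_comp_inclPlace_iff_of_forall_apply_eq_smul (P : DiscreteAutomorphicRep (adelicGroupData F E c N J) μ)
    (χ : (adelicGroupData F E c N J).Adelic →* ℂˣ) (hχ : Continuous fun g => ((χ g : ℂˣ) : ℂ))
    (hP : ∀ (g : (adelicGroupData F E c N J).Adelic) (f : P.space.toSubmodule), P.space.toContRep g f = ((χ g : ℂˣ) : ℂ) • f)
    (v : HeightOneSpectrum (𝓞 F)) (c₀ : IrrClass (localPi E c N J v)) :
    c₀.IsConstituentOf (P.finRep.smoothPart.toRepresentation.comp (inclPlace F E c N J v)) ↔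
      c₀ = IrrClass.mk (SmoothIrrep.ofChar (χ.comp (inclPlaceAdelic F E c N J v)) (isOpen_ker_comp_inclPlaceAdelic χ hχ v)) := by
  -- the smooth part is everything, in particular non-trivial
  have htop : P.finRep.smoothPart.toSubmodule = ⊤ :=
    (Representation.isSmooth_iff_smoothPart_eq_top P.finRep).1 (isSmooth_finRep_of_forall_apply_eq_smul P χ hχ hP)
  haveI : Nontrivial ↥P.finRep.smoothPart.toSubmodule := by
    haveI := P.nontrivial_space
    obtain ⟨f, hf⟩ := exists_ne (0 : P.space.toSubmodule)
    exact ⟨⟨⟨f, by rw [htop]; trivial⟩, 0, fun h0 => hf (congrArg Subtype.val h0)⟩⟩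
  -- the smooth part is `χ ∘ finAdelicToAdelic`-scalar
  have hsc : ∀ (y : finAdelic F E c N J) (x : ↥P.finRep.smoothPart.toSubmodule),
      P.finRep.smoothPart.toRepresentation y x = (((χ.comp (finAdelicToAdelic F E c N J)) y : ℂˣ) : ℂ) • x := fun y x =>
    Subtype.ext (finRep_apply_of_forall_apply_eq_smul P χ hP y x)
  exact IrrClass.isConstituentOf_comp_iff_eq_mk_ofChar_of_forall_apply_eq_smul _ _ (inclPlace F E c N J v) _ hsc c₀

/-- The same, with the local character spelled `(χ ∘ finAdelicToAdelic) ∘ inclPlace v` and ANY open-kernel witness (proof-irrelevant). [cite: FlathCorvallis1979, Thm. 3] -/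
theorem isConstituentOf_finRep_smoothPart_comp_inclPlace_iff_of_forall_apply_eq_smul' (P : DiscreteAutomorphicRep (adelicGroupData F E c N J) μ)
    (χ : (adelicGroupData F E c N J).Adelic →* ℂˣ) (hχ : Continuous fun g => ((χ g : ℂˣ) : ℂ))
    (hP : ∀ (g : (adelicGroupData F E c N J).Adelic) (f : P.space.toSubmodule), P.space.toContRep g f = ((χ g : ℂˣ) : ℂ) • f)
    (v : HeightOneSpectrum (𝓞 F)) {χv : localPi E c N J v →* ℂˣ} (hχv : IsOpen ((χv.ker : Subgroup (localPi E c N J v)) : Set (localPi E c N J v)))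
    (hχvχ : ∀ u, χv u = χ (finAdelicToAdelic F E c N J (inclPlace F E c N J v u))) (c₀ : IrrClass (localPi E c N J v)) :
    c₀.IsConstituentOf (P.finRep.smoothPart.toRepresentation.comp (inclPlace F E c N J v)) ↔ c₀ = IrrClass.mk (SmoothIrrep.ofChar χv hχv) := by
  have hχv' : χv = χ.comp (inclPlaceAdelic F E c N J v) := MonoidHom.ext fun u => hχvχ u
  subst hχv'
  exact isConstituentOf_finRep_smoothPart_comp_inclPlace_iff_of_forall_apply_eq_smul P χ hχ hP v c₀

end UnitaryGroup

end Literature.NumberTheory.Automorphic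

end
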